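import Summits.BirchSwinnertonDyer.BirchSwinnertonDyer.Theorems.SchneiderFreeAdditiveX3PoitouTateMiddleExactTools
import HarnessLib

/-!
# Route `SchneiderFreeAdditiveX3` (K1 door), control corner: Milne I Thm. 4.10(b) for THE invariant maps
# is MULTIPLICATIVE over coprime levels — `hE(ab) ⟸ hE(a) ∧ hE(b)` — hence the Poitou–Tate
# Selmer-structure fact `poitouTate_selmerStructure_duality K` ⟸ `hE` at PRIME-POWER levels alone

Cell `bsd-schneider-ideate`, seat `bsd-schneider-door-c4` (prover, generation 9). PARTITION: board row
B6 ∩ X3 ∩ sst-twist, `r = 1` — CONTROL corner (crux `AnticycControlAdditiveK`, stmt-BirchSwinnertonDyer-19295;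
facts binder `ControlFacts` (i), stmt-19538); SHRINKS `ControlFacts` (i) BY NAME to the printed statement
`hE` (Milne *ADT* I Thm. 4.10(b), `r = 1`, `Ker γ¹ ⊆ Im β¹`, for `LocalInvariants.canonical K (p^k)`) at
PRIME-POWER levels; closes nothing by itself (BSD not advanced; `hE(p^k)` is door-c6's line).

* §1 `zmodLevelHom` facts: the embedding `ℤ/a → ℤ/(ab)`, `r ↦ r·b`, is additive and injective (as an
  existence statement); `ι_* π_* = e` on local classes; sub-representations of unramified modules are
  unramified.
* §2 **`middleExact_canonical_of_coprime`**: for `a ⊥ b`, `hE(canonical K a) → hE(canonical K b) →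
  hE(canonical K (ab))`.  Given `t ∈ ⊕_{v∈S} H¹(K_v, M)` orthogonal (level `ab`) to `H¹_S(K, M^D)`: its
  projection `π_{a,*} t` is orthogonal (level `a`) to `H¹_S(K, Hom(M[a], μ_a))` — for `y'` there,
  `Ψ_a y' ∈ H¹_S(K, M^D)` and `inv_v^{(ab)}(t_v ∪ Ψ_a y') = b · inv_v^{(a)}(π t_v ∪ y')`
  (`localTatePairingZMod_canonical_map_torsionProj`), and `r ↦ r·b` is injective — so `hE(a)` gives
  `x_a ∈ H¹_S(K, M[a])` with `loc x_a = π_a t`; likewise `x_b`; then `x = ι_a x_a + ι_b x_b` has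
  `loc_v x = (e + e')·t_v = t_v`.
* §3 **`poitouTate_selmerStructure_duality_of_middleExact_canonical_primePow`**:
  `(∀ p k, p prime → 0 < k → hE(canonical K (p^k))) → poitouTate_selmerStructure_duality K`
  (`Nat.recOnPosPrimePosCoprime`; level `1`: `M = 0`).

References: [MilneADT2006] I Thm. 4.10(b), Cor. 2.3; [Howard2004HeegnerKolyvagin] Thm. 2.1.11;
[CasselsFrohlich1967] VII §11 (reduction to prime-power layers).
-/

noncomputable section

open CategoryTheory Function NumberField IsDedekindDomain
open scoped NumberField ContRepresentation

universe u

-- D-0017 layout: summit = sub-problem (`Summit.BirchSwinnertonDyer.BirchSwinnertonDyer.…`), as in the sockets files.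
set_option linter.dupNamespace false
set_option autoImplicit false

namespace Summit.BirchSwinnertonDyer.BirchSwinnertonDyer.Theorems.SchneiderFreeAdditiveX3.PoitouTateReduction

open Field
open Literature.NumberTheory.GaloisRepresentations Literature.NumberTheory.GaloisCohomology
open _root_.TopRep _root_.ContRepresentation _root_.ContinuousCohomology
open Literature.NumberTheory.GaloisRepresentations.DiscreteGaloisModule (mu MuCarrier TateDual tateDual
  localTatePairingZMod unramifiedSubgroup homOfIntertwining)
open Summit.BirchSwinnertonDyer.Rank1Residual.X11b

/-! ## §1. Small tools -/

section Tools

/-- **The embedding `ℤ/c → ℤ/n`, `r ↦ r · (n/c)`, is additive and injective** (`c ∣ n`, `n ≥ 1`).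
[cite: Lang2002, Ch. II §2 Thm. 2.1 (consequence)] -/
theorem exists_zmod_level_embedding (c n : ℕ) [NeZero c] [NeZero n] (hcn : c ∣ n) :
    ∃ ψ : ZMod c →+ ZMod n, Injective ψ ∧ ∀ r : ZMod c, ψ r = ((r.val * (n / c) : ℕ) : ZMod n) := by
  obtain ⟨d, rfl⟩ := hcn
  have hd : d ≠ 0 := fun h => NeZero.ne (c * d) (by rw [h, mul_zero])
  have hdiv : c * d / c = d := Nat.mul_div_cancel_left d (NeZero.pos c)
  have hcast : ∀ x : ℕ, (((x % c) * d : ℕ) : ZMod (c * d)) = ((x * d : ℕ) : ZMod (c * d)) := fun x =>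
    (ZMod.natCast_eq_natCast_iff _ _ _).2 ((Nat.mod_modEq x c).mul_right' d)
  refine ⟨{ toFun := fun r => ((r.val * (c * d / c) : ℕ) : ZMod (c * d))
            map_zero' := by rw [ZMod.val_zero, zero_mul, Nat.cast_zero]
            map_add' := fun r s => ?_ }, ?_, fun r => rfl⟩
  · change (((r + s).val * (c * d / c) : ℕ) : ZMod (c * d)) =
      ((r.val * (c * d / c) : ℕ) : ZMod (c * d)) + ((s.val * (c * d / c) : ℕ) : ZMod (c * d))
    rw [hdiv, ZMod.val_add, hcast, add_mul, Nat.cast_add]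
  · refine (injective_iff_map_eq_zero _).2 fun r hr => ?_
    change ((r.val * (c * d / c) : ℕ) : ZMod (c * d)) = 0 at hr
    rw [hdiv, ZMod.natCast_eq_zero_iff] at hr
    have hrc : c ∣ r.val := Nat.dvd_of_mul_dvd_mul_right (Nat.pos_of_ne_zero hd) hr
    have hr0 : r.val = 0 := Nat.eq_zero_of_dvd_of_lt hrc (ZMod.val_lt r)
    exact (ZMod.val_eq_zero r).1 hr0

/-- A sub-representation of a module unramified at `v` is unramified at `v` (inertia acts trivially on
`M`, hence on `M[a]`). [cite: MilneADT2006, Ch. I §2, before Thm. 2.6] -/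
theorem isUnramifiedAt_torsionRep {K : Type u} [Field K] [NumberField K] {M : Type u} [AddCommGroup M]
    [TopologicalSpace M] [DiscreteTopology M] (ρ : DiscreteGaloisModule K M) (v : HeightOneSpectrum (𝓞 K))
    (hur : GaloisRep.IsUnramifiedAt v ρ) (a : ℕ) :
    GaloisRep.IsUnramifiedAt v (ρ.torsionRep a) := by
  rw [GaloisRep.isUnramifiedAt_iff_toLocal_holds]
  intro σ hσ
  have h := (GaloisRep.isUnramifiedAt_iff_toLocal_holds v ρ).1 hur σ hσ
  refine LinearMap.ext fun x => Subtype.ext ?_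
  exact LinearMap.congr_fun h (x : M)

variable {K : Type u} [Field K] [NumberField K]
  {M : Type u} [AddCommGroup M] [TopologicalSpace M] [DiscreteTopology M]
  (ρ : DiscreteGaloisModule K M) {a e : ℕ}

/-- **`ι_* π_* = e` on `H¹(K_v, M)`** for `ι : M[a] ⊆ M` and `π = e· : M → M[a]` (any place `v`).
[cite: SerreGaloisCohomology1997, I §2.2 and §2.4] -/
theorem map_torsionIncl_map_torsionProj
    (ι : (ρ.torsionRep a).toContRepresentation →ⁱL ρ.toContRepresentation)
    (hι : ∀ x : Submodule.torsionBy ℤ M (a : ℤ), ι x = (x : M))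
    (π : ρ.toContRepresentation →ⁱL (ρ.torsionRep a).toContRepresentation)
    (hπ : ∀ m : M, (π m : M) = e • m) (v : Place K) (t : galoisCohomology (ρ.toLocal v) 1) :
    galoisCohomology.map (ι.restrictField (Place.Completion v)) 1
        (galoisCohomology.map (π.restrictField (Place.Completion v)) 1 t) = e • t := by
  set E := Place.Completion (K := K) v with hE
  rw [← DiscreteGaloisModule.cohomologyMap_homOfIntertwining, ← DiscreteGaloisModule.cohomologyMap_homOfIntertwining,
    ← map_comp_apply_of (ContinuousMonoidHom.id _) (ContinuousMonoidHom.id _) (ContinuousMonoidHom.id _)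
      (fun _ => rfl) (resIdHom (homOfIntertwining (π.restrictField E)))
      (resIdHom (homOfIntertwining (ι.restrictField E)))
      (resIdHom (homOfIntertwining (π.restrictField E) ≫ homOfIntertwining (ι.restrictField E)))
      (fun _ => rfl) 1 t]
  refine cohomologyMap_one_eq_nsmul (ρ.toLocal v) _ e (fun m => ?_) t
  change ι (π m) = e • m
  rw [hι, hπ]

end Tools

/-! ## §2. `hE` is multiplicative over coprime levels -/

section Coprime

variable {K : Type} [Field K] [NumberField K]

/-- **Milne I Thm. 4.10(b) `Ker γ¹ ⊆ Im β¹` for THE invariant maps is multiplicative over coprime levels**: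
for `a ⊥ b`, the statement `hE` at level `a` and at level `b` imply it at level `ab`.  For `t ∈ ⊕_{v∈S}
H¹(K_v, M)` (`ab·M = 0`) orthogonal at level `ab` to every `y ∈ H¹(K, M^D)` unramified outside `S`: with
CRT idempotents `e ≡ 1 (a), 0 (b)`, `e' ≡ 1 (b), 0 (a)`, the projections `π_a = e·`, `π_b = e'·`, the
inclusions `ι_a`, `ι_b` and the extensions `Ψ_a`, `Ψ_b` of Tate duals
(`…PoitouTateMiddleExactTools`), `π_{a,*} t` is orthogonal at level `a` to every
`y' ∈ H¹(K, Hom(M[a], μ_a))` unramified outside `S` — because `Ψ_{a,*} y' ∈ H¹(K, M^D)` is unramified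
outside `S` and `inv_v^{(ab)}(t_v ∪ Ψ_a y') = b·inv_v^{(a)}(π_a t_v ∪ y')` at every `v`
(`localTatePairingZMod_canonical_map_torsionProj`) with `r ↦ r·b : ℤ/a ↪ ℤ/(ab)` injective — so `hE(a)`
yields `x_a ∈ H¹(K, M[a])` unramified outside `S` with `loc x_a = π_{a,*} t`; likewise `x_b`; and
`x = ι_{a,*} x_a + ι_{b,*} x_b` has `loc_v x = (e + e')·t_v = t_v`.
[cite: MilneADT2006, Ch. I, Thm. 4.10(b)] [cite: CasselsFrohlich1967, Ch. VII §11] -/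
theorem middleExact_canonical_of_coprime {a b : ℕ} [NeZero a] [NeZero b] (hab : a.Coprime b)
    (hEa : ∀ ⦃M : Type⦄ [AddCommGroup M] [TopologicalSpace M] [DiscreteTopology M] [Finite M]
      (ρ : DiscreteGaloisModule K M), (∀ m : M, a • m = 0) →
      ∀ S : Finset (Place K), (∀ w : InfinitePlace K, (Sum.inl w : Place K) ∈ S) →
        (∀ v : HeightOneSpectrum (𝓞 K), (Sum.inr v : Place K) ∉ S →
          ((a : ℕ) : 𝓞 K) ∉ v.asIdeal ∧ GaloisRep.IsUnramifiedAt v ρ) →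
        ∀ t : Π v : Place K, galoisCohomology (ρ.toLocal v) 1,
          (∀ y : galoisCohomology (ρ.tateDual a) 1,
            (∀ v : HeightOneSpectrum (𝓞 K), (Sum.inr v : Place K) ∉ S →
              galoisCohomology.localization (ρ.tateDual a) (Sum.inr v) 1 y ∈
                unramifiedSubgroup (GaloisRep.toLocal v (ρ.tateDual a)) 1) →
            ∑ v ∈ S, localTatePairingZMod ρ a v (LocalInvariants.canonical K a v) (t v)
              (galoisCohomology.localization (ρ.tateDual a) v 1 y) = 0) →
          ∃ x : galoisCohomology ρ 1,
            (∀ v : HeightOneSpectrum (𝓞 K), (Sum.inr v : Place K) ∉ S →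
              galoisCohomology.localization ρ (Sum.inr v) 1 x ∈
                unramifiedSubgroup (GaloisRep.toLocal v ρ) 1) ∧
            ∀ v ∈ S, galoisCohomology.localization ρ v 1 x = t v)
    (hEb : ∀ ⦃M : Type⦄ [AddCommGroup M] [TopologicalSpace M] [DiscreteTopology M] [Finite M]
      (ρ : DiscreteGaloisModule K M), (∀ m : M, b • m = 0) →
      ∀ S : Finset (Place K), (∀ w : InfinitePlace K, (Sum.inl w : Place K) ∈ S) →
        (∀ v : HeightOneSpectrum (𝓞 K), (Sum.inr v : Place K) ∉ S →
          ((b : ℕ) : 𝓞 K) ∉ v.asIdeal ∧ GaloisRep.IsUnramifiedAt v ρ) →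
        ∀ t : Π v : Place K, galoisCohomology (ρ.toLocal v) 1,
          (∀ y : galoisCohomology (ρ.tateDual b) 1,
            (∀ v : HeightOneSpectrum (𝓞 K), (Sum.inr v : Place K) ∉ S →
              galoisCohomology.localization (ρ.tateDual b) (Sum.inr v) 1 y ∈
                unramifiedSubgroup (GaloisRep.toLocal v (ρ.tateDual b)) 1) →
            ∑ v ∈ S, localTatePairingZMod ρ b v (LocalInvariants.canonical K b v) (t v)
              (galoisCohomology.localization (ρ.tateDual b) v 1 y) = 0) →
          ∃ x : galoisCohomology ρ 1,
            (∀ v : HeightOneSpectrum (𝓞 K), (Sum.inr v : Place K) ∉ S →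
              galoisCohomology.localization ρ (Sum.inr v) 1 x ∈
                unramifiedSubgroup (GaloisRep.toLocal v ρ) 1) ∧
            ∀ v ∈ S, galoisCohomology.localization ρ v 1 x = t v) :
    ∀ ⦃M : Type⦄ [AddCommGroup M] [TopologicalSpace M] [DiscreteTopology M] [Finite M]
      (ρ : DiscreteGaloisModule K M), (∀ m : M, (a * b) • m = 0) →
      ∀ S : Finset (Place K), (∀ w : InfinitePlace K, (Sum.inl w : Place K) ∈ S) →
        (∀ v : HeightOneSpectrum (𝓞 K), (Sum.inr v : Place K) ∉ S →
          ((a * b : ℕ) : 𝓞 K) ∉ v.asIdeal ∧ GaloisRep.IsUnramifiedAt v ρ) →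
        ∀ t : Π v : Place K, galoisCohomology (ρ.toLocal v) 1,
          (∀ y : galoisCohomology (ρ.tateDual (a * b)) 1,
            (∀ v : HeightOneSpectrum (𝓞 K), (Sum.inr v : Place K) ∉ S →
              galoisCohomology.localization (ρ.tateDual (a * b)) (Sum.inr v) 1 y ∈
                unramifiedSubgroup (GaloisRep.toLocal v (ρ.tateDual (a * b))) 1) →
            ∑ v ∈ S, localTatePairingZMod ρ (a * b) v (LocalInvariants.canonical K (a * b) v) (t v)
              (galoisCohomology.localization (ρ.tateDual (a * b)) v 1 y) = 0) →
          ∃ x : galoisCohomology ρ 1,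
            (∀ v : HeightOneSpectrum (𝓞 K), (Sum.inr v : Place K) ∉ S →
              galoisCohomology.localization ρ (Sum.inr v) 1 x ∈
                unramifiedSubgroup (GaloisRep.toLocal v ρ) 1) ∧
            ∀ v ∈ S, galoisCohomology.localization ρ v 1 x = t v := by
  intro M _ _ _ _ ρ hM S hinf hS t horth
  classical
  -- one projection-and-lift step, for a general coprime splitting `n = c·d`, the `c`-part
  have step : ∀ {c d : ℕ} [NeZero c] (hcd : c * d = a * b)
      (hEc : ∀ ⦃M : Type⦄ [AddCommGroup M] [TopologicalSpace M] [DiscreteTopology M] [Finite M]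
        (ρ : DiscreteGaloisModule K M), (∀ m : M, c • m = 0) →
        ∀ S : Finset (Place K), (∀ w : InfinitePlace K, (Sum.inl w : Place K) ∈ S) →
          (∀ v : HeightOneSpectrum (𝓞 K), (Sum.inr v : Place K) ∉ S →
            ((c : ℕ) : 𝓞 K) ∉ v.asIdeal ∧ GaloisRep.IsUnramifiedAt v ρ) →
          ∀ t : Π v : Place K, galoisCohomology (ρ.toLocal v) 1,
            (∀ y : galoisCohomology (ρ.tateDual c) 1,
              (∀ v : HeightOneSpectrum (𝓞 K), (Sum.inr v : Place K) ∉ S →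
                galoisCohomology.localization (ρ.tateDual c) (Sum.inr v) 1 y ∈
                  unramifiedSubgroup (GaloisRep.toLocal v (ρ.tateDual c)) 1) →
              ∑ v ∈ S, localTatePairingZMod ρ c v (LocalInvariants.canonical K c v) (t v)
                (galoisCohomology.localization (ρ.tateDual c) v 1 y) = 0) →
            ∃ x : galoisCohomology ρ 1,
              (∀ v : HeightOneSpectrum (𝓞 K), (Sum.inr v : Place K) ∉ S →
                galoisCohomology.localization ρ (Sum.inr v) 1 x ∈
                  unramifiedSubgroup (GaloisRep.toLocal v ρ) 1) ∧
              ∀ v ∈ S, galoisCohomology.localization ρ v 1 x = t v)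
      {e : ℕ} (he1 : e ≡ 1 [MOD c]) (he0 : e ≡ 0 [MOD d]),
      ∃ x : galoisCohomology ρ 1,
        (∀ v : HeightOneSpectrum (𝓞 K), (Sum.inr v : Place K) ∉ S →
          galoisCohomology.localization ρ (Sum.inr v) 1 x ∈ unramifiedSubgroup (GaloisRep.toLocal v ρ) 1) ∧
        ∀ v ∈ S, galoisCohomology.localization ρ v 1 x = e • t v := by
    intro c d _ hcd hEc e he1 he0
    have hMcd : ∀ m : M, (c * d) • m = 0 := fun m => by rw [hcd]; exact hM m
    have hcn : c ∣ a * b := ⟨d, hcd.symm⟩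
    -- the maps
    obtain ⟨ι, hι⟩ := exists_torsionIncl_intertwining ρ c
    obtain ⟨π, hπ⟩ := exists_torsionProj_intertwining ρ he0 hMcd
    obtain ⟨Ψ, hΨ⟩ := exists_tateDual_extend_intertwining ρ hcn he0 hMcd
    obtain ⟨j, hj⟩ := exists_muIncl_intertwining K hcn
    obtain ⟨ψ, hψinj, hψ⟩ := exists_zmod_level_embedding c (a * b) hcn
    -- hypotheses of `hEc` for `M[c]`
    have hSc : ∀ v : HeightOneSpectrum (𝓞 K), (Sum.inr v : Place K) ∉ S →
        ((c : ℕ) : 𝓞 K) ∉ v.asIdeal ∧ GaloisRep.IsUnramifiedAt v (ρ.torsionRep c) := by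
      intro v hv
      refine ⟨fun h => (hS v hv).1 ?_, isUnramifiedAt_torsionRep ρ v (hS v hv).2 c⟩
      rw [← hcd, Nat.cast_mul]
      exact v.asIdeal.mul_mem_right _ h
    let tc := fun v : Place K => galoisCohomology.map (π.restrictField (Place.Completion v)) 1 (t v)
    have horthc : ∀ y' : galoisCohomology (tateDual (ρ.torsionRep c) c) 1,
        (∀ v : HeightOneSpectrum (𝓞 K), (Sum.inr v : Place K) ∉ S →
          galoisCohomology.localization (tateDual (ρ.torsionRep c) c) (Sum.inr v) 1 y' ∈
            unramifiedSubgroup (GaloisRep.toLocal v (tateDual (ρ.torsionRep c) c)) 1) →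
        ∑ v ∈ S, localTatePairingZMod (ρ.torsionRep c) c v (LocalInvariants.canonical K c v) (tc v)
          (galoisCohomology.localization (tateDual (ρ.torsionRep c) c) v 1 y') = 0 := by
      intro y' hy'
      -- `y := Ψ_* y'` is unramified outside `S`
      set y := galoisCohomology.map Ψ 1 y' with hydef
      have hlocy : ∀ v : Place K, galoisCohomology.localization (ρ.tateDual (a * b)) v 1 y =
          galoisCohomology.map (Ψ.restrictField (Place.Completion v)) 1
            (galoisCohomology.localization (tateDual (ρ.torsionRep c) c) v 1 y') := fun v =>
        galoisCohomology.res_map_one _ Ψ y'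
      have hy : ∀ v : HeightOneSpectrum (𝓞 K), (Sum.inr v : Place K) ∉ S →
          galoisCohomology.localization (ρ.tateDual (a * b)) (Sum.inr v) 1 y ∈
            unramifiedSubgroup (GaloisRep.toLocal v (ρ.tateDual (a * b))) 1 := fun v hv => by
        rw [hlocy]
        exact Levels.map_mem_unramifiedSubgroup _ (hy' v hv)
      have h0 := horth y hy
      -- termwise level change
      have hterm : ∀ v ∈ S, localTatePairingZMod ρ (a * b) v (LocalInvariants.canonical K (a * b) v) (t v)
          (galoisCohomology.localization (ρ.tateDual (a * b)) v 1 y) =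
            ψ (localTatePairingZMod (ρ.torsionRep c) c v (LocalInvariants.canonical K c v) (tc v)
              (galoisCohomology.localization (tateDual (ρ.torsionRep c) c) v 1 y')) := fun v _ => by
        rw [hlocy, hψ]
        exact localTatePairingZMod_canonical_map_torsionProj ρ he1 he0 hMcd hcn ι hι π hπ Ψ hΨ j hj v (t v) _
      rw [Finset.sum_congr rfl hterm, ← map_sum] at h0
      exact (injective_iff_map_eq_zero ψ).1 hψinj _ h0
    obtain ⟨xc, hxc_ur, hxc⟩ := hEc (ρ.torsionRep c) (nsmul_torsionRep_eq_zero c) S hinf hSc tc horthc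
    refine ⟨galoisCohomology.map ι 1 xc, fun v hv => ?_, fun v hv => ?_⟩
    · rw [show galoisCohomology.localization ρ (Sum.inr v) 1 (galoisCohomology.map ι 1 xc) =
          galoisCohomology.map (ι.restrictField (Place.Completion (Sum.inr v))) 1
            (galoisCohomology.localization (ρ.torsionRep c) (Sum.inr v) 1 xc) from
        galoisCohomology.res_map_one _ ι xc]
      exact Levels.map_mem_unramifiedSubgroup _ (hxc_ur v hv)
    · rw [show galoisCohomology.localization ρ v 1 (galoisCohomology.map ι 1 xc) =
          galoisCohomology.map (ι.restrictField (Place.Completion v)) 1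
            (galoisCohomology.localization (ρ.torsionRep c) v 1 xc) from
        galoisCohomology.res_map_one _ ι xc, hxc v hv]
      exact map_torsionIncl_map_torsionProj ρ ι hι π hπ v (t v)
  -- the two parts
  obtain ⟨e, he1, he0⟩ := exists_crt_one_zero hab
  obtain ⟨e', he1', he0'⟩ := exists_crt_one_zero hab.symm
  obtain ⟨xa, hxa_ur, hxa⟩ := step rfl hEa he1 he0
  obtain ⟨xb, hxb_ur, hxb⟩ := step (mul_comm b a) hEb he1' he0'
  refine ⟨xa + xb, fun v hv => ?_, fun v hv => ?_⟩
  · rw [map_add]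
    exact AddSubgroup.add_mem _ (hxa_ur v hv) (hxb_ur v hv)
  · rw [map_add, hxa v hv, hxb v hv, ← add_nsmul]
    -- `e + e' ≡ 1 (mod ab)` and `ab · t v = 0`
    have hee : e + e' ≡ 1 [MOD a * b] :=
      (Nat.modEq_and_modEq_iff_modEq_mul hab).1
        ⟨by simpa using he1.add he0', by simpa using he0.add he1'⟩
    exact nsmul_eq_self_of_modEq_one hee (nsmul_continuousCohomology_one_eq_zero _ (a * b) hM (t v))

end Coprime

/-! ## §3. The Poitou–Tate fact from `hE` at PRIME-POWER levels -/

section PrimePow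

variable {K : Type} [Field K] [NumberField K]

/-- **`poitouTate_selmerStructure_duality K` ⟸ Milne I Thm. 4.10(b) for THE invariant maps at PRIME-POWER
levels.**  If for every prime `p` and `k ≥ 1` the statement `hE` (`Ker γ¹ ⊆ Im β¹`, `r = 1`, for
`LocalInvariants.canonical K (p^k)`, every finite discrete module killed by `p^k`, every admissible `S`) holds,
then the named fact `poitouTate_selmerStructure_duality K` (ControlFacts (i) of the route; consumed by the
tree's ~1 300 `hPT` binders) HOLDS: `hE` at every level `n ≥ 1` by induction on the coprime factorisation
(`middleExact_canonical_of_coprime`; level `1`: `M = 0`), then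
`poitouTate_selmerStructure_duality_of_middleExact_canonical` (UnramifiedOrthogonal at every `n`,
`…PoitouTateUnramifiedOrthogonalAllLevels`). [cite: MilneADT2006, Ch. I, Thm. 4.10(b)]
[cite: CasselsFrohlich1967, Ch. VII §11] [cite: Howard2004HeegnerKolyvagin, Thm. 2.1.11 (arXiv:1202.6340 p. 6)] -/
theorem poitouTate_selmerStructure_duality_of_middleExact_canonical_primePow
    (hE : ∀ (p k : ℕ), p.Prime → 0 < k → ∀ [NeZero (p ^ k)],
      ∀ ⦃M : Type⦄ [AddCommGroup M] [TopologicalSpace M] [DiscreteTopology M] [Finite M]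
      (ρ : DiscreteGaloisModule K M), (∀ m : M, (p ^ k) • m = 0) →
      ∀ S : Finset (Place K), (∀ w : InfinitePlace K, (Sum.inl w : Place K) ∈ S) →
        (∀ v : HeightOneSpectrum (𝓞 K), (Sum.inr v : Place K) ∉ S →
          ((p ^ k : ℕ) : 𝓞 K) ∉ v.asIdeal ∧ GaloisRep.IsUnramifiedAt v ρ) →
        ∀ t : Π v : Place K, galoisCohomology (ρ.toLocal v) 1,
          (∀ y : galoisCohomology (ρ.tateDual (p ^ k)) 1,
            (∀ v : HeightOneSpectrum (𝓞 K), (Sum.inr v : Place K) ∉ S →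
              galoisCohomology.localization (ρ.tateDual (p ^ k)) (Sum.inr v) 1 y ∈
                unramifiedSubgroup (GaloisRep.toLocal v (ρ.tateDual (p ^ k))) 1) →
            ∑ v ∈ S, localTatePairingZMod ρ (p ^ k) v (LocalInvariants.canonical K (p ^ k) v) (t v)
              (galoisCohomology.localization (ρ.tateDual (p ^ k)) v 1 y) = 0) →
          ∃ x : galoisCohomology ρ 1,
            (∀ v : HeightOneSpectrum (𝓞 K), (Sum.inr v : Place K) ∉ S →
              galoisCohomology.localization ρ (Sum.inr v) 1 x ∈
                unramifiedSubgroup (GaloisRep.toLocal v ρ) 1) ∧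
            ∀ v ∈ S, galoisCohomology.localization ρ v 1 x = t v) :
    poitouTate_selmerStructure_duality K := by
  refine poitouTate_selmerStructure_duality_of_middleExact_canonical fun n => ?_
  -- `hE` at every level `n ≥ 1`, by induction on the coprime factorisation
  induction n using Nat.recOnPosPrimePosCoprime with
  | zero => intro h; exact absurd rfl (NeZero.ne 0)
  | one =>
    intro _ M _ _ _ _ ρ hM S hinf hS t horth
    haveI : Subsingleton M := ⟨fun x y => by rw [← one_nsmul x, ← one_nsmul y, hM, hM]⟩
    have ht : ∀ v : Place K, t v = 0 := fun v => by
      haveI : Subsingleton (ρ.toLocal v).toTopRep := ‹Subsingleton M›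
      exact @Subsingleton.elim _ (subsingleton_continuousCohomology_of_subsingleton (ρ.toLocal v).toTopRep 0) _ _
    exact ⟨0, fun v hv => by rw [map_zero]; exact zero_mem _, fun v hv => by rw [map_zero, ht v]⟩
  | prime_pow p k hp hk => intro _; exact hE p k hp hk
  | coprime a b ha hb hab iha ihb =>
    intro _
    haveI : NeZero a := ⟨by omega⟩
    haveI : NeZero b := ⟨by omega⟩
    exact middleExact_canonical_of_coprime hab iha ihb

end PrimePow

end Summit.BirchSwinnertonDyer.BirchSwinnertonDyer.Theorems.SchneiderFreeAdditiveX3.PoitouTateReduction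

end
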